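import Summits.BirchSwinnertonDyer.BirchSwinnertonDyer.Theses.SignedLowerHalves
import Literature.NumberTheory.EllipticCurves.Rank1Residual.Typed.X6
import Literature.NumberTheory.EllipticCurves.Rank1Residual.Typed.X7
import Literature.NumberTheory.EllipticCurves.Rank1Residual.Typed.X8
import Literature.NumberTheory.EllipticCurves.Isogeny
import Summits.BirchSwinnertonDyer.Rank1Residual.Supersingular.KobayashiMainConjecture
import Summits.BirchSwinnertonDyer.Rank1Residual.Supersingular.KobayashiMainConjectureX7
import Summits.BirchSwinnertonDyer.Rank1Residual.Supersingular.SignedRankOneCorA5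
import Summits.BirchSwinnertonDyer.Rank1Residual.Supersingular.SharpFlatRankZeroReal
import Summits.BirchSwinnertonDyer.Rank1Residual.Partition.MainConjecturesSignedLowerDivisibilityClasses
import Summits.BirchSwinnertonDyer.Rank1Residual.Partition.MainConjecturesCMSupersingular
import HarnessLib


/-!
# BC3 birth skeleton v2 — crux `SprungLowerHalfAtThree` (route SignedLowerHalves, rank 5)
Two genuine pieces: (A) the REAL OBJECTS exist for an X8 pair — a newform `f` of `W` with `ϖ·Ω_E = Ω⁺_f` and a
Sprung ♯/♭ pair `(L♯, L♭)` for `(f, p, a_p)` (Sprung 2012 JNT construction + modularity + Manin-constant unit at 3: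
published, but not yet a Literature fact in this typing); (B) for THOSE objects, a chroma `c` whose signed datum has the
Euler-characteristic property (K•, Sprung 2024 Lem 5.5–5.9 = cite `wi-68275`) AND the Eisenstein divisibility
`ξ ∣ ϖ·L^c` up to a unit (the ♯/♭ lower half at (3, ±3): PRE / conditional in print). (B) is the hard stub.

v2 (planner g10) = the A12 shape `#h21_check_skeleton` accepts: the two stubs are the ONLY sorried declarations and the
composition `SprungLowerHalfAtThree_of` concludes the crux BY NAME with NO hypotheses, invoking the stubs by name
(v1's ∀-binders on `_of` read as `skeleton.extra-hypothesis`). Same mathematics as v1 (evidence bd627cb27691b6e0 /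
tree `Lines/birth.lean` 2026-08-25T22:12Z).
-/

set_option autoImplicit false

namespace Summit.BirchSwinnertonDyer.BirchSwinnertonDyer.Cruxes.SprungLowerHalfAtThree


namespace Birth

/-- stub (A): the real objects exist (newform, period unit, Sprung pair). -/
theorem stub_sprungPair : ∀ (W : WeierstrassCurve ℚ) [W.IsElliptic] [W.IsGloballyMinimal] (p : ℕ) [Fact p.Prime],
    Literature.NumberTheory.EllipticCurves.Rank1Residual.ClassX8 W p →
    ∃ (N : ℕ) (_ : NeZero N) (f : CuspForm (CongruenceSubgroup.Gamma0 N) 2) (ϖ : ℚ) (Lsharp Lflat : Literature.NumberTheory.EllipticCurves.IwasawaAlgebra p),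
      Literature.NumberTheory.EllipticCurves.ModularForms.IsNewformOf W f ∧ (ϖ : ℝ) * W.realPeriodRat = Literature.NumberTheory.EllipticCurves.ModularForms.plusPeriod f ∧
      Literature.NumberTheory.EllipticCurves.Sprung2017.IsSprungPair f p (W.frobeniusTrace p) Lsharp Lflat := by
  sorry

/-- stub (B): chromatic Euler characteristic + ♯/♭ Eisenstein divisibility for the given pair. -/
theorem stub_chromaticDivisibility : ∀ (W : WeierstrassCurve ℚ) [W.IsElliptic] [W.IsGloballyMinimal] (p : ℕ) [Fact p.Prime],
    Literature.NumberTheory.EllipticCurves.Rank1Residual.ClassX8 W p →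
    ∀ (N : ℕ) (_ : NeZero N) (f : CuspForm (CongruenceSubgroup.Gamma0 N) 2) (ϖ : ℚ) (Lsharp Lflat : Literature.NumberTheory.EllipticCurves.IwasawaAlgebra p),
      Literature.NumberTheory.EllipticCurves.ModularForms.IsNewformOf W f → (ϖ : ℝ) * W.realPeriodRat = Literature.NumberTheory.EllipticCurves.ModularForms.plusPeriod f → Literature.NumberTheory.EllipticCurves.Sprung2017.IsSprungPair f p (W.frobeniusTrace p) Lsharp Lflat →
      ∃ (c : Literature.NumberTheory.EllipticCurves.Sprung2017.Chroma) (ξ : Literature.NumberTheory.EllipticCurves.IwasawaAlgebra p), (⟨ξ, 0, 0⟩ : Summit.BirchSwinnertonDyer.Rank1Residual.Supersingular.SignedDatum W p).EulerCharacteristic ∧ ∃ h : Literature.NumberTheory.EllipticCurves.IwasawaAlgebra p, Literature.NumberTheory.EllipticCurves.iwasawaToPowerSeries p ξ = PowerSeries.C (ϖ : ℚ_[p]) * Literature.NumberTheory.EllipticCurves.iwasawaToPowerSeries p (Literature.NumberTheory.EllipticCurves.Sprung2017.chromaticL c Lsharp Lflat * h) := by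
  sorry

/-- composition = THE SKELETON: the crux BY NAME from exactly the two registered stubs; kernel-checked, no sorry of
its own. -/
theorem SprungLowerHalfAtThree_of :
    Summit.BirchSwinnertonDyer.BirchSwinnertonDyer.Theses.SignedLowerHalves.SprungLowerHalfAtThree := by
  intro W _ _ p _ hX
  obtain ⟨N, hN, f, ϖ, Lsharp, Lflat, hf, hϖ, hSP⟩ := stub_sprungPair W p hX
  obtain ⟨c, ξ, hK, hdiv⟩ := stub_chromaticDivisibility W p hX N hN f ϖ Lsharp Lflat hf hϖ hSP
  exact ⟨N, hN, f, ϖ, Lsharp, Lflat, c, ξ, hf, hϖ, hSP, hK, hdiv⟩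

end Birth

end Summit.BirchSwinnertonDyer.BirchSwinnertonDyer.Cruxes.SprungLowerHalfAtThree
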